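import Mathlib
import Summits.Ventures.PercRepro2.CoinChainOdds
import Summits.Ventures.PercRepro2.CoinChainNoPivot00
import Summits.Ventures.PercRepro2.CoinChainDecreasing

/-!
# The GENERAL AND-switch chain (`a` entered from `ent ⊆ U` surely and from `a'` by the coin)
under the odds, no-pivotality and decreasing-density conditions
(blind cell PercRepro2, night-2 g19; proofs/NIGHT2-DARC.md §59.16)

The three conditions that rest only on `mixture_lsm` and the four-atom sandwich / FKG do not
see the entry set: the κ-integrated laws `ν · chainMix ent ent' ρ c d` and
`ν · chainMix ent ent' ρ c d'` are log-supermodular for EVERY `ent, ent'` (`mixture_lsm`), so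
`chain_functional_nonneg_of_odds`, `chain_functional_nonneg_of_noPivot00` (no pivotality on
the marker-free clusters meeting `ent ∪ ent'`) and `chain_functional_nonneg_of_decreasing` hold
for the general chain verbatim.  (The A-world theorems are for the pure chain only, §59.11.)
-/

namespace Summit.Ventures.PercRepro2.Coin

section ChainGeneralEnt

variable {V : Type*} [DecidableEq V] {R : Type*} [Field R] [LinearOrder R] [IsStrictOrderedRing R]

/-- **THE GENERAL CHAIN UNDER THE ODDS CONDITIONS** (`a` entered from `ent ⊆ U` surely and from
`a'` by the coin).  With the hypotheses of `mixture_lsm` for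
`(c, d')` (the gate log-supermodular), and the two odds conditions between the gate's marker
atoms and the `R`-law's marker sums, the cleared functional is `≥ 0` at every `ρ`. -/
theorem chain_functional_nonneg_of_odds (U ent ent' : Finset V) (ν c d d' : Finset V → R)
    (ρ : R) (hρ0 : 0 ≤ ρ) (hρ1 : ρ ≤ 1) (hν0 : ∀ W, 0 ≤ ν W)
    (hν : ∀ s ⊆ U, ∀ t ⊆ U, ν s * ν t ≤ ν (s ∩ t) * ν (s ∪ t))
    (hc0 : ∀ W, 0 ≤ c W) (hd0 : ∀ W, 0 ≤ d W) (hd'0 : ∀ W, 0 ≤ d' W) (hd'c : ∀ W, d' W ≤ c W)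
    (hcc : ∀ s t, c s * c t ≤ c (s ∩ t) * c (s ∪ t))
    (hd'd' : ∀ s t, d' s * d' t ≤ d' (s ∩ t) * d' (s ∪ t))
    (hcd' : ∀ s t, c s * d' t ≤ c (s ∩ t) * d' (s ∪ t))
    (hratio' : ∀ s t, s ⊆ t → d' s * c t ≤ c s * d' t) (m₁ m₂ : V)
    (hodd₁ : (∑ W ∈ U.powerset, ν W * chainMix ent ent' ρ c d' W * ((if m₁ ∈ W then (1 : R) else 0) *
        (1 - if m₂ ∈ W then (1 : R) else 0))) *
        (∑ W ∈ U.powerset, ν W * chainMix ent ent' ρ c d W * (1 - if m₁ ∈ W then (1 : R) else 0)) ≤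
      (∑ W ∈ U.powerset, ν W * chainMix ent ent' ρ c d' W * ((1 - if m₁ ∈ W then (1 : R) else 0) *
        (1 - if m₂ ∈ W then (1 : R) else 0))) *
        (∑ W ∈ U.powerset, ν W * chainMix ent ent' ρ c d W * (if m₁ ∈ W then (1 : R) else 0)))
    (hodd₂ : (∑ W ∈ U.powerset, ν W * chainMix ent ent' ρ c d' W * ((1 - if m₁ ∈ W then (1 : R) else 0) *
        (if m₂ ∈ W then (1 : R) else 0))) *
        (∑ W ∈ U.powerset, ν W * chainMix ent ent' ρ c d W * (1 - if m₂ ∈ W then (1 : R) else 0)) ≤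
      (∑ W ∈ U.powerset, ν W * chainMix ent ent' ρ c d' W * ((1 - if m₁ ∈ W then (1 : R) else 0) *
        (1 - if m₂ ∈ W then (1 : R) else 0))) *
        (∑ W ∈ U.powerset, ν W * chainMix ent ent' ρ c d W * (if m₂ ∈ W then (1 : R) else 0))) :
    0 ≤ (∑ W ∈ U.powerset, ν W * chainMix ent ent' ρ c d W) ^ 2 *
          (∑ W ∈ U.powerset, ν W * chainMix ent ent' ρ c d' W *
            ((if m₁ ∈ W then (1 : R) else 0) * (if m₂ ∈ W then (1 : R) else 0)))
        - (∑ W ∈ U.powerset, ν W * chainMix ent ent' ρ c d W) *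
          (∑ W ∈ U.powerset, ν W * chainMix ent ent' ρ c d W * (if m₁ ∈ W then (1 : R) else 0)) *
          (∑ W ∈ U.powerset, ν W * chainMix ent ent' ρ c d' W * (if m₂ ∈ W then (1 : R) else 0))
        - (∑ W ∈ U.powerset, ν W * chainMix ent ent' ρ c d W) *
          (∑ W ∈ U.powerset, ν W * chainMix ent ent' ρ c d W * (if m₂ ∈ W then (1 : R) else 0)) *
          (∑ W ∈ U.powerset, ν W * chainMix ent ent' ρ c d' W * (if m₁ ∈ W then (1 : R) else 0))
        + (∑ W ∈ U.powerset, ν W * chainMix ent ent' ρ c d W * (if m₁ ∈ W then (1 : R) else 0)) *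
          (∑ W ∈ U.powerset, ν W * chainMix ent ent' ρ c d W * (if m₂ ∈ W then (1 : R) else 0)) *
          (∑ W ∈ U.powerset, ν W * chainMix ent ent' ρ c d' W) := by
  have hm0 : ∀ W, 0 ≤ chainMix ent ent' ρ c d W := chainMix_nonneg ent ent' hρ0 hρ1 hc0 hd0
  have hm'0 : ∀ W, 0 ≤ chainMix ent ent' ρ c d' W := chainMix_nonneg ent ent' hρ0 hρ1 hc0 hd'0
  have hmix' := mixture_lsm ent ent' ρ hρ0 hρ1 c d' hc0 hd'0 hd'c hcc hd'd' hcd' hratio'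
  refine fourAtom_functional_nonneg_of_odds U (fun W => ν W * chainMix ent ent' ρ c d W)
    (fun W => ν W * chainMix ent ent' ρ c d' W) m₁ m₂
    (fun W => mul_nonneg (hν0 W) (hm0 W)) (fun W => mul_nonneg (hν0 W) (hm'0 W)) ?_ hodd₁ hodd₂
  intro s hs t ht
  calc ν s * chainMix ent ent' ρ c d' s * (ν t * chainMix ent ent' ρ c d' t)
      = (ν s * ν t) * (chainMix ent ent' ρ c d' s * chainMix ent ent' ρ c d' t) := by ring
    _ ≤ (ν (s ∩ t) * ν (s ∪ t)) *
          (chainMix ent ent' ρ c d' (s ∩ t) * chainMix ent ent' ρ c d' (s ∪ t)) :=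
        mul_le_mul (hν s hs t ht) (hmix' s t) (mul_nonneg (hm'0 _) (hm'0 _))
          (mul_nonneg (hν0 _) (hν0 _))
    _ = _ := by ring

/-- **THE GENERAL CHAIN WITH NO PIVOTALITY ON THE MARKER-FREE CLUSTERS** (`a` entered from
`ent ⊆ U` surely and from `a'` by the coin).  With the hypotheses of
`mixture_lsm` for `(c, d)` and `(c, d')`, `d' ≤ d`, and `d' W = d W` on every entered cluster
`W` missing both markers (`h00`), the cleared functional is `≥ 0` — by the four-atom sandwich
`fourAtom_functional_nonneg'`. -/
theorem chain_functional_nonneg_of_noPivot00 (U ent ent' : Finset V) (ν c d d' : Finset V → R)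
    (ρ : R) (hρ0 : 0 ≤ ρ) (hρ1 : ρ ≤ 1) (hν0 : ∀ W, 0 ≤ ν W)
    (hν : ∀ s ⊆ U, ∀ t ⊆ U, ν s * ν t ≤ ν (s ∩ t) * ν (s ∪ t))
    (hc0 : ∀ W, 0 ≤ c W) (hd0 : ∀ W, 0 ≤ d W) (hd'0 : ∀ W, 0 ≤ d' W)
    (hdc : ∀ W, d W ≤ c W) (hd'c : ∀ W, d' W ≤ c W) (hd'd : ∀ W, d' W ≤ d W)
    (hcc : ∀ s t, c s * c t ≤ c (s ∩ t) * c (s ∪ t))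
    (hdd : ∀ s t, d s * d t ≤ d (s ∩ t) * d (s ∪ t))
    (hd'd' : ∀ s t, d' s * d' t ≤ d' (s ∩ t) * d' (s ∪ t))
    (hcd : ∀ s t, c s * d t ≤ c (s ∩ t) * d (s ∪ t))
    (hcd' : ∀ s t, c s * d' t ≤ c (s ∩ t) * d' (s ∪ t))
    (hratio : ∀ s t, s ⊆ t → d s * c t ≤ c s * d t)
    (hratio' : ∀ s t, s ⊆ t → d' s * c t ≤ c s * d' t) (m₁ m₂ : V)
    (h00 : ∀ W ⊆ U, m₁ ∉ W → m₂ ∉ W → (∃ r ∈ ent ∪ ent', r ∈ W) → d' W = d W) :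
    0 ≤ (∑ W ∈ U.powerset, ν W * chainMix ent ent' ρ c d W) ^ 2 *
          (∑ W ∈ U.powerset, ν W * chainMix ent ent' ρ c d' W *
            ((if m₁ ∈ W then (1 : R) else 0) * (if m₂ ∈ W then (1 : R) else 0)))
        - (∑ W ∈ U.powerset, ν W * chainMix ent ent' ρ c d W) *
          (∑ W ∈ U.powerset, ν W * chainMix ent ent' ρ c d W * (if m₁ ∈ W then (1 : R) else 0)) *
          (∑ W ∈ U.powerset, ν W * chainMix ent ent' ρ c d' W * (if m₂ ∈ W then (1 : R) else 0))
        - (∑ W ∈ U.powerset, ν W * chainMix ent ent' ρ c d W) *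
          (∑ W ∈ U.powerset, ν W * chainMix ent ent' ρ c d W * (if m₂ ∈ W then (1 : R) else 0)) *
          (∑ W ∈ U.powerset, ν W * chainMix ent ent' ρ c d' W * (if m₁ ∈ W then (1 : R) else 0))
        + (∑ W ∈ U.powerset, ν W * chainMix ent ent' ρ c d W * (if m₁ ∈ W then (1 : R) else 0)) *
          (∑ W ∈ U.powerset, ν W * chainMix ent ent' ρ c d W * (if m₂ ∈ W then (1 : R) else 0)) *
          (∑ W ∈ U.powerset, ν W * chainMix ent ent' ρ c d' W) := by
  have hm0 : ∀ W, 0 ≤ chainMix ent ent' ρ c d W := chainMix_nonneg ent ent' hρ0 hρ1 hc0 hd0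
  have hm'0 : ∀ W, 0 ≤ chainMix ent ent' ρ c d' W := chainMix_nonneg ent ent' hρ0 hρ1 hc0 hd'0
  have hmix := mixture_lsm ent ent' ρ hρ0 hρ1 c d hc0 hd0 hdc hcc hdd hcd hratio
  have hmix' := mixture_lsm ent ent' ρ hρ0 hρ1 c d' hc0 hd'0 hd'c hcc hd'd' hcd' hratio'
  refine fourAtom_functional_nonneg' U (fun W => ν W * chainMix ent ent' ρ c d W)
    (fun W => ν W * chainMix ent ent' ρ c d' W) m₁ m₂
    (fun W => mul_nonneg (hν0 W) (hm0 W)) (fun W => mul_nonneg (hν0 W) (hm'0 W)) ?_ ?_ ?_ ?_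
  · intro s hs t ht
    calc ν s * chainMix ent ent' ρ c d s * (ν t * chainMix ent ent' ρ c d t)
        = (ν s * ν t) * (chainMix ent ent' ρ c d s * chainMix ent ent' ρ c d t) := by ring
      _ ≤ (ν (s ∩ t) * ν (s ∪ t)) *
            (chainMix ent ent' ρ c d (s ∩ t) * chainMix ent ent' ρ c d (s ∪ t)) :=
          mul_le_mul (hν s hs t ht) (hmix s t) (mul_nonneg (hm0 _) (hm0 _))
            (mul_nonneg (hν0 _) (hν0 _))
      _ = _ := by ring
  · intro s hs t ht
    calc ν s * chainMix ent ent' ρ c d' s * (ν t * chainMix ent ent' ρ c d' t)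
        = (ν s * ν t) * (chainMix ent ent' ρ c d' s * chainMix ent ent' ρ c d' t) := by ring
      _ ≤ (ν (s ∩ t) * ν (s ∪ t)) *
            (chainMix ent ent' ρ c d' (s ∩ t) * chainMix ent ent' ρ c d' (s ∪ t)) :=
          mul_le_mul (hν s hs t ht) (hmix' s t) (mul_nonneg (hm'0 _) (hm'0 _))
            (mul_nonneg (hν0 _) (hν0 _))
      _ = _ := by ring
  · intro W _
    refine mul_le_mul_of_nonneg_left ?_ (hν0 W)
    unfold chainMix
    have := chainTheta_nonneg ent ent' hρ0 W
    nlinarith [hd'd W]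
  · intro W hW h1 h2
    have hWU : W ⊆ U := Finset.mem_powerset.1 hW
    unfold chainMix chainTheta
    by_cases h0 : ∃ r ∈ ent, r ∈ W
    · have hu : ∃ r ∈ ent ∪ ent', r ∈ W := by
        obtain ⟨r, hr, hrW⟩ := h0; exact ⟨r, Finset.mem_union_left _ hr, hrW⟩
      rw [if_pos h0, h00 W hWU h1 h2 hu]
    · by_cases h1' : ∃ r ∈ ent', r ∈ W
      · have hu : ∃ r ∈ ent ∪ ent', r ∈ W := by
          obtain ⟨r, hr, hrW⟩ := h1'; exact ⟨r, Finset.mem_union_right _ hr, hrW⟩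
        rw [if_neg h0, if_pos h1', h00 W hWU h1 h2 hu]
      · rw [if_neg h0, if_neg h1']; ring

/-- **THE GENERAL CHAIN WITH A DECREASING GATE DENSITY** (`a` entered from `ent ⊆ U` surely
and from `a'` by the coin).  `ν` log-supermodular on `U.powerset`,
the head values with the hypotheses of `mixture_lsm` for `(c, d)` and `(c, d')`, `d' ≤ d`, and
the gate density decreasing (`hdec`): the cleared functional is `≥ 0`.  Proof: FKG for the
gate and the Holley comparison gate `≼` `R`-law (both marker means of the gate lie below the
`R`-means), so the shift product is nonnegative. -/
theorem chain_functional_nonneg_of_decreasing (U ent ent' : Finset V) (ν c d d' : Finset V → R)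
    (ρ : R) (hρ0 : 0 ≤ ρ) (hρ1 : ρ ≤ 1) (hν0 : ∀ W, 0 ≤ ν W)
    (hν : ∀ s ⊆ U, ∀ t ⊆ U, ν s * ν t ≤ ν (s ∩ t) * ν (s ∪ t))
    (hc0 : ∀ W, 0 ≤ c W) (hd0 : ∀ W, 0 ≤ d W) (hd'0 : ∀ W, 0 ≤ d' W)
    (hdc : ∀ W, d W ≤ c W) (hd'c : ∀ W, d' W ≤ c W) (hd'd : ∀ W, d' W ≤ d W)
    (hcc : ∀ s t, c s * c t ≤ c (s ∩ t) * c (s ∪ t))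
    (hdd : ∀ s t, d s * d t ≤ d (s ∩ t) * d (s ∪ t))
    (hd'd' : ∀ s t, d' s * d' t ≤ d' (s ∩ t) * d' (s ∪ t))
    (hcd : ∀ s t, c s * d t ≤ c (s ∩ t) * d (s ∪ t))
    (hcd' : ∀ s t, c s * d' t ≤ c (s ∩ t) * d' (s ∪ t))
    (hratio : ∀ s t, s ⊆ t → d s * c t ≤ c s * d t)
    (hratio' : ∀ s t, s ⊆ t → d' s * c t ≤ c s * d' t)
    (hdec : ∀ s t, s ⊆ t → chainMix ent ent' ρ c d' t * chainMix ent ent' ρ c d s ≤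
      chainMix ent ent' ρ c d' s * chainMix ent ent' ρ c d t) (m₁ m₂ : V) :
    0 ≤ (∑ W ∈ U.powerset, ν W * chainMix ent ent' ρ c d W) ^ 2 *
          (∑ W ∈ U.powerset, ν W * chainMix ent ent' ρ c d' W *
            ((if m₁ ∈ W then (1 : R) else 0) * (if m₂ ∈ W then (1 : R) else 0)))
        - (∑ W ∈ U.powerset, ν W * chainMix ent ent' ρ c d W) *
          (∑ W ∈ U.powerset, ν W * chainMix ent ent' ρ c d W * (if m₁ ∈ W then (1 : R) else 0)) *
          (∑ W ∈ U.powerset, ν W * chainMix ent ent' ρ c d' W * (if m₂ ∈ W then (1 : R) else 0))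
        - (∑ W ∈ U.powerset, ν W * chainMix ent ent' ρ c d W) *
          (∑ W ∈ U.powerset, ν W * chainMix ent ent' ρ c d W * (if m₂ ∈ W then (1 : R) else 0)) *
          (∑ W ∈ U.powerset, ν W * chainMix ent ent' ρ c d' W * (if m₁ ∈ W then (1 : R) else 0))
        + (∑ W ∈ U.powerset, ν W * chainMix ent ent' ρ c d W * (if m₁ ∈ W then (1 : R) else 0)) *
          (∑ W ∈ U.powerset, ν W * chainMix ent ent' ρ c d W * (if m₂ ∈ W then (1 : R) else 0)) *
          (∑ W ∈ U.powerset, ν W * chainMix ent ent' ρ c d' W) := by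
  have hx0 : ∀ W : Finset V, (0 : R) ≤ (if m₁ ∈ W then (1 : R) else 0) := by
    intro W; split_ifs <;> norm_num
  have hy0 : ∀ W : Finset V, (0 : R) ≤ (if m₂ ∈ W then (1 : R) else 0) := by
    intro W; split_ifs <;> norm_num
  have hxm : ∀ s t : Finset V,
      (if m₁ ∈ s then (1 : R) else 0) ≤ (if m₁ ∈ s ∪ t then (1 : R) else 0) := by
    intro s t
    by_cases h : m₁ ∈ s
    · rw [if_pos h, if_pos (Finset.mem_union_left t h)]
    · rw [if_neg h]; split_ifs <;> norm_num
  have hym : ∀ s t : Finset V,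
      (if m₂ ∈ s then (1 : R) else 0) ≤ (if m₂ ∈ s ∪ t then (1 : R) else 0) := by
    intro s t
    by_cases h : m₂ ∈ s
    · rw [if_pos h, if_pos (Finset.mem_union_left t h)]
    · rw [if_neg h]; split_ifs <;> norm_num
  obtain ⟨Rl, hRl⟩ : ∃ Rl : Finset V → R, ∀ W, Rl W = ν W * chainMix ent ent' ρ c d W :=
    ⟨_, fun _ => rfl⟩
  obtain ⟨Gl, hGl⟩ : ∃ Gl : Finset V → R, ∀ W, Gl W = ν W * chainMix ent ent' ρ c d' W :=
    ⟨_, fun _ => rfl⟩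
  have hm0 : ∀ W, 0 ≤ chainMix ent ent' ρ c d W := chainMix_nonneg ent ent' hρ0 hρ1 hc0 hd0
  have hm'0 : ∀ W, 0 ≤ chainMix ent ent' ρ c d' W := chainMix_nonneg ent ent' hρ0 hρ1 hc0 hd'0
  have hmle : ∀ W, chainMix ent ent' ρ c d' W ≤ chainMix ent ent' ρ c d W := by
    intro W
    unfold chainMix
    have := chainTheta_nonneg ent ent' hρ0 W
    nlinarith [hd'd W]
  have hR0 : ∀ W, 0 ≤ Rl W := fun W => by rw [hRl]; exact mul_nonneg (hν0 W) (hm0 W)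
  have hG0 : ∀ W, 0 ≤ Gl W := fun W => by rw [hGl]; exact mul_nonneg (hν0 W) (hm'0 W)
  have hmix := mixture_lsm ent ent' ρ hρ0 hρ1 c d hc0 hd0 hdc hcc hdd hcd hratio
  have hmix' := mixture_lsm ent ent' ρ hρ0 hρ1 c d' hc0 hd'0 hd'c hcc hd'd' hcd' hratio'
  have hGlsm : ∀ s ⊆ U, ∀ t ⊆ U, Gl s * Gl t ≤ Gl (s ∩ t) * Gl (s ∪ t) := by
    intro s hs t ht
    rw [hGl, hGl, hGl, hGl]
    calc ν s * chainMix ent ent' ρ c d' s * (ν t * chainMix ent ent' ρ c d' t)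
        = (ν s * ν t) * (chainMix ent ent' ρ c d' s * chainMix ent ent' ρ c d' t) := by ring
      _ ≤ (ν (s ∩ t) * ν (s ∪ t)) *
            (chainMix ent ent' ρ c d' (s ∩ t) * chainMix ent ent' ρ c d' (s ∪ t)) :=
          mul_le_mul (hν s hs t ht) (hmix' s t) (mul_nonneg (hm'0 _) (hm'0 _))
            (mul_nonneg (hν0 _) (hν0 _))
      _ = _ := by ring
  have hdom : ∀ s ⊆ U, ∀ t ⊆ U, Gl s * Rl t ≤ Gl (s ∩ t) * Rl (s ∪ t) := by
    intro s hs t ht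
    rw [hGl, hGl, hRl, hRl]
    have key := holley_of_density_dec (chainMix ent ent' ρ c d) (chainMix ent ent' ρ c d') hm0 hm'0
      hmix hmle hdec s t
    calc ν s * chainMix ent ent' ρ c d' s * (ν t * chainMix ent ent' ρ c d t)
        = (ν s * ν t) * (chainMix ent ent' ρ c d' s * chainMix ent ent' ρ c d t) := by ring
      _ ≤ (ν (s ∩ t) * ν (s ∪ t)) *
            (chainMix ent ent' ρ c d' (s ∩ t) * chainMix ent ent' ρ c d (s ∪ t)) :=
          mul_le_mul (hν s hs t ht) key (mul_nonneg (hm'0 _) (hm0 _))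
            (mul_nonneg (hν0 _) (hν0 _))
      _ = _ := by ring
  have hFG := aw_fkg_sums U Gl (fun W => if m₁ ∈ W then (1 : R) else 0)
    (fun W => if m₂ ∈ W then (1 : R) else 0) hG0 hx0 hy0 hxm hym hGlsm
  have hH1 := aw_holley_sums U Gl Rl (fun W => if m₁ ∈ W then (1 : R) else 0) hG0 hR0 hx0 hxm
    hdom
  have hH2 := aw_holley_sums U Gl Rl (fun W => if m₂ ∈ W then (1 : R) else 0) hG0 hR0 hy0 hym
    hdom
  have hx1 : ∀ W : Finset V, (if m₁ ∈ W then (1 : R) else 0) ≤ 1 := by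
    intro W; split_ifs <;> norm_num
  have hy1 : ∀ W : Finset V, (if m₂ ∈ W then (1 : R) else 0) ≤ 1 := by
    intro W; split_ifs <;> norm_num
  have hg0 : 0 ≤ ∑ W ∈ U.powerset, Gl W := Finset.sum_nonneg fun W _ => hG0 W
  have hg1 : 0 ≤ ∑ W ∈ U.powerset, Gl W * (if m₁ ∈ W then (1 : R) else 0) :=
    Finset.sum_nonneg fun W _ => mul_nonneg (hG0 W) (hx0 W)
  have hg2 : 0 ≤ ∑ W ∈ U.powerset, Gl W * (if m₂ ∈ W then (1 : R) else 0) :=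
    Finset.sum_nonneg fun W _ => mul_nonneg (hG0 W) (hy0 W)
  have hg12 : 0 ≤ ∑ W ∈ U.powerset, Gl W *
      ((if m₁ ∈ W then (1 : R) else 0) * (if m₂ ∈ W then (1 : R) else 0)) :=
    Finset.sum_nonneg fun W _ => mul_nonneg (hG0 W) (mul_nonneg (hx0 W) (hy0 W))
  have hg1le : ∑ W ∈ U.powerset, Gl W * (if m₁ ∈ W then (1 : R) else 0) ≤
      ∑ W ∈ U.powerset, Gl W :=
    Finset.sum_le_sum fun W _ => mul_le_of_le_one_right (hG0 W) (hx1 W)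
  have hg2le : ∑ W ∈ U.powerset, Gl W * (if m₂ ∈ W then (1 : R) else 0) ≤
      ∑ W ∈ U.powerset, Gl W :=
    Finset.sum_le_sum fun W _ => mul_le_of_le_one_right (hG0 W) (hy1 W)
  have hg12le : ∑ W ∈ U.powerset, Gl W *
      ((if m₁ ∈ W then (1 : R) else 0) * (if m₂ ∈ W then (1 : R) else 0)) ≤
      ∑ W ∈ U.powerset, Gl W :=
    Finset.sum_le_sum fun W _ =>
      mul_le_of_le_one_right (hG0 W) (mul_le_one₀ (hx1 W) (hy0 W) (hy1 W))
  have eR : ∀ f : Finset V → R, ∑ W ∈ U.powerset, ν W * chainMix ent ent' ρ c d W * f W =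
      ∑ W ∈ U.powerset, Rl W * f W := fun f => Finset.sum_congr rfl fun W _ => by rw [hRl]
  have eG : ∀ f : Finset V → R, ∑ W ∈ U.powerset, ν W * chainMix ent ent' ρ c d' W * f W =
      ∑ W ∈ U.powerset, Gl W * f W := fun f => Finset.sum_congr rfl fun W _ => by rw [hGl]
  have eR0 : ∑ W ∈ U.powerset, ν W * chainMix ent ent' ρ c d W = ∑ W ∈ U.powerset, Rl W :=
    Finset.sum_congr rfl fun W _ => by rw [hRl]
  have eG0 : ∑ W ∈ U.powerset, ν W * chainMix ent ent' ρ c d' W = ∑ W ∈ U.powerset, Gl W :=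
    Finset.sum_congr rfl fun W _ => by rw [hGl]
  rw [eR0, eG0, eR (fun W => if m₁ ∈ W then (1 : R) else 0), eR (fun W => if m₂ ∈ W then (1 : R) else 0),
    eG (fun W => if m₁ ∈ W then (1 : R) else 0), eG (fun W => if m₂ ∈ W then (1 : R) else 0),
    eG (fun W => (if m₁ ∈ W then (1 : R) else 0) * (if m₂ ∈ W then (1 : R) else 0))]
  exact dec_T_nonneg _ _ _ _ _ _ _ hg0 hg1 hg2 hg12 hg1le hg2le hg12le hFG hH1 hH2

end ChainGeneralEnt

end Summit.Ventures.PercRepro2.Coin
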